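import Mathlib.MeasureTheory.Integral.IntegralEqImproper
import Mathlib.MeasureTheory.Integral.ExpDecay
import Mathlib.MeasureTheory.Integral.Prod
import Mathlib.MeasureTheory.Integral.IntervalIntegral.IntegrationByParts
import Literature.Analysis.FluidPDE.StretchedLayerSliceCalculus
import HarnessLib

/-!
# Integration on the period strip `(0, L] × ℝ` for curried plane fields

Analysis/FluidPDE support file (everything proved, no definitions, no named facts). It collects
the measure-theoretic tools behind the `L²` energy method on the period strip
`{(x, y) : 0 < x ≤ L, y ∈ ℝ}` of an `x`-periodic planar flow (Majda–Bertozzi, *Vorticity and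
Incompressible Flow*, CUP 2002, §3.1.1, Prop. 3.1 / Cor. 3.1, and the Remark after Prop. 3.4:
energy estimates for a finite-energy perturbation of a non-decaying background), written for the
curried plane fields `f : ℝ → ℝ → ℝ`, `f x y`, and the slice derivatives `StretchedLayer.dX`,
`StretchedLayer.dY` of `StretchedLayerNS` (their calculus is `StretchedLayerSliceCalculus`):

* the strip measure: `volume.restrict (Ioc 0 L ×ˢ univ) = (volume.restrict (Ioc 0 L)).prod volume`
  (so that Mathlib's Fubini–Tonelli `integral_prod` / `integral_prod_symm` apply to set
  integrals `∫ q in Ioc 0 L ×ˢ univ, …`);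
* exponential weights across the layer: `y ↦ e^{-k|y|}` and `y ↦ (1 + |y|)² e^{-k|y|}` are
  integrable, functions dominated by `K e^{-k|y|}` tend to `0` as `y → ±∞`, pointwise weight
  bookkeeping for products (decaying × at most quadratically growing), and: a continuous function
  dominated on the strip by an integrable function of `y` alone is integrable on the strip
  (`integrableOn_strip_of_abs_le`, `integrableOn_strip_of_abs_le_sq_exp`);
* **integration by parts on the strip**: in `x` over a period for `L`-periodic products
  (`integral_strip_mul_dX_eq_neg`, boundary terms cancel), in `y` over `ℝ` for integrable
  products (`integral_strip_mul_dY_eq_neg`, Mathlib's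
  `integral_mul_deriv_eq_deriv_mul_of_integrable` slice by slice), and the one-sided version
  `∫∫ f ∂_y∂_y f ≤ 0` needing only `f ∂_yf → 0` at `|y| = ∞` (`integral_strip_mul_dYdY_self_nonpos`,
  by truncation to `[-R, R]`, where `∫ (∂_yf)² ≥ 0`), together with its periodic `x`-analogue.

All statements are folklore calculus; they are consumed by the period-rigidity theorem for the
stretched layer system in the energy class (`StretchedLayerEnergyRigidity`).

## Mathlib / tree search

Mathlib: `integral_mul_deriv_eq_deriv_mul_of_integrable`, `intervalIntegral_tendsto_integral`,
`intervalIntegral.integral_mul_deriv_eq_deriv_mul`, `MeasureTheory.integral_prod(_symm)`,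
`Integrable.comp_snd`, `Measure.restrict_prod_eq_prod_univ`, `exp_neg_integrableOn_Ioi`.
Tree: whole-space versions under polynomial decay in `EnergyUniqueness`
(`integral_fderiv_apply_eq_neg_integral_mul_divergence`), many local copies of
`integrable_exp_neg_mul_abs` (e.g. `Literature.Analysis.Complex.integrable_exp_neg_mul_abs`,
re-proved here privately to keep the imports light).
-/

noncomputable section

open Set Function Filter intervalIntegral
open _root_.MeasureTheory
open scoped Topology

namespace Literature.Analysis.FluidPDE

namespace StretchedLayer

/-! ### The measure on the period strip -/

/-- The restriction of Lebesgue measure to the strip `(0, L] × ℝ` is the product of the restricted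
one-dimensional measures (so Mathlib's Fubini theorems apply). [folklore] -/
theorem volume_restrict_strip (L : ℝ) :
    (volume : Measure (ℝ × ℝ)).restrict (Ioc 0 L ×ˢ univ) =
      ((volume : Measure ℝ).restrict (Ioc 0 L)).prod (volume : Measure ℝ) := by
  rw [Measure.volume_eq_prod, Measure.restrict_prod_eq_prod_univ]

/-- Almost every point of the strip has abscissa in `(0, L]`. [folklore] -/
theorem ae_fst_mem_Ioc_strip (L : ℝ) :
    ∀ᵐ q : ℝ × ℝ ∂(volume.restrict (Ioc 0 L ×ˢ univ)), q.1 ∈ Ioc 0 L :=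
  (ae_restrict_mem (measurableSet_Ioc.prod MeasurableSet.univ)).mono fun _ hq => hq.1

/-! ### Exponential weights across the layer -/

/-- `y ↦ e^{−k|y|}` is integrable on `ℝ` for `k > 0` (private copy; public versions exist in
`Literature.Analysis.Complex.integrable_exp_neg_mul_abs` and elsewhere, not in this import
closure). [folklore] -/
private theorem integrable_exp_neg_mul_abs_layer {k : ℝ} (hk : 0 < k) :
    Integrable fun y : ℝ => Real.exp (-k * |y|) := by
  have hIoi : IntegrableOn (fun t : ℝ => Real.exp (-k * |t|)) (Ioi 0) := by
    refine (exp_neg_integrableOn_Ioi 0 hk).congr_fun (fun t ht => ?_) measurableSet_Ioi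
    rw [abs_of_pos (mem_Ioi.1 ht)]
  have hIic : IntegrableOn (fun t : ℝ => Real.exp (-k * |t|)) (Iic 0) := by
    rw [← Measure.map_neg_eq_self (volume : Measure ℝ)]
    let m : MeasurableEmbedding fun x : ℝ => -x := (Homeomorph.neg ℝ).measurableEmbedding
    rw [m.integrableOn_map_iff]
    simp_rw [Function.comp_def, abs_neg, neg_preimage, neg_Iic, neg_zero]
    rw [integrableOn_Ici_iff_integrableOn_Ioi]
    exact hIoi
  have := hIic.union hIoi
  rwa [Iic_union_Ioi, integrableOn_univ] at this

/-- `1 + |y| ≤ e^{c|y|} / min c 1` for `c > 0` (from `1 + s ≤ eˢ`). [folklore] -/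
theorem one_add_abs_le_exp_mul {c : ℝ} (hc : 0 < c) (y : ℝ) :
    1 + |y| ≤ Real.exp (c * |y|) / min c 1 := by
  have hm : 0 < min c 1 := lt_min hc one_pos
  rw [le_div_iff₀ hm]
  have h1 : min c 1 ≤ 1 := min_le_right _ _
  have h2 : min c 1 * |y| ≤ c * |y| := mul_le_mul_of_nonneg_right (min_le_left _ _) (abs_nonneg y)
  have h3 : c * |y| + 1 ≤ Real.exp (c * |y|) := Real.add_one_le_exp _
  nlinarith [abs_nonneg y]

/-- `(1 + |y|)² e^{−k|y|} ≤ e^{−(k/2)|y|} / (min (k/4) 1)²`. [folklore] -/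
theorem one_add_abs_sq_mul_exp_le {k : ℝ} (hk : 0 < k) (y : ℝ) :
    (1 + |y|) ^ 2 * Real.exp (-k * |y|) ≤ Real.exp (-(k / 2) * |y|) / (min (k / 4) 1) ^ 2 := by
  have hm : 0 < min (k / 4) 1 := lt_min (by positivity) one_pos
  have h1 := one_add_abs_le_exp_mul (c := k / 4) (by positivity) y
  have h0 : 0 ≤ 1 + |y| := by positivity
  have h2 : (1 + |y|) ^ 2 ≤ (Real.exp (k / 4 * |y|) / min (k / 4) 1) ^ 2 := pow_le_pow_left₀ h0 h1 2
  have e2 : Real.exp (k / 4 * |y|) ^ 2 * Real.exp (-k * |y|) = Real.exp (-(k / 2) * |y|) := by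
    rw [← Real.exp_nat_mul, ← Real.exp_add]
    congr 1
    push_cast
    ring
  calc (1 + |y|) ^ 2 * Real.exp (-k * |y|)
      ≤ (Real.exp (k / 4 * |y|) / min (k / 4) 1) ^ 2 * Real.exp (-k * |y|) :=
        mul_le_mul_of_nonneg_right h2 (Real.exp_pos _).le
    _ = Real.exp (-(k / 2) * |y|) / (min (k / 4) 1) ^ 2 := by
        rw [div_pow, div_mul_eq_mul_div, e2]

/-- `y ↦ (1 + |y|)² e^{−k|y|}` is integrable on `ℝ` for `k > 0`. [folklore] -/
theorem integrable_one_add_abs_sq_mul_exp {k : ℝ} (hk : 0 < k) :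
    Integrable fun y : ℝ => (1 + |y|) ^ 2 * Real.exp (-k * |y|) := by
  refine ((integrable_exp_neg_mul_abs_layer (half_pos hk)).div_const ((min (k / 4) 1) ^ 2)).mono'
    (by fun_prop) (Eventually.of_forall fun y => ?_)
  rw [Real.norm_of_nonneg (by positivity)]
  convert one_add_abs_sq_mul_exp_le hk y using 3

/-- `e^{−k|y|} ≤ (1 + |y|)² e^{−k|y|}`. [folklore] -/
theorem exp_le_one_add_abs_sq_mul_exp (k y : ℝ) :
    Real.exp (-k * |y|) ≤ (1 + |y|) ^ 2 * Real.exp (-k * |y|) := by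
  have h1 : (1 : ℝ) ≤ (1 + |y|) ^ 2 := one_le_pow₀ (by linarith [abs_nonneg y])
  nlinarith [Real.exp_pos (-k * |y|)]

/-- `|y| e^{−k|y|} ≤ (1 + |y|)² e^{−k|y|}`. [folklore] -/
theorem abs_mul_exp_le_one_add_abs_sq_mul_exp (k y : ℝ) :
    |y| * Real.exp (-k * |y|) ≤ (1 + |y|) ^ 2 * Real.exp (-k * |y|) := by
  have h1 : |y| ≤ (1 + |y|) ^ 2 := by nlinarith [abs_nonneg y]
  exact mul_le_mul_of_nonneg_right h1 (Real.exp_pos _).le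

/-- A function dominated by `K e^{−k|y|}`, `k > 0`, tends to `0` as `y → +∞`. [folklore] -/
theorem tendsto_zero_atTop_of_abs_le_exp {F : ℝ → ℝ} {K k : ℝ} (hk : 0 < k)
    (h : ∀ y, |F y| ≤ K * Real.exp (-k * |y|)) : Tendsto F atTop (𝓝 0) := by
  have h1 : Tendsto (fun y : ℝ => -k * |y|) atTop atBot := by
    have h2 := (tendsto_abs_atTop_atTop (G := ℝ)).const_mul_atTop hk
    have h2' : Tendsto (fun y : ℝ => -(k * |y|)) atTop atBot := tendsto_neg_atBot_iff.2 h2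
    simpa only [neg_mul] using h2'
  have h3 : Tendsto (fun y : ℝ => K * Real.exp (-k * |y|)) atTop (𝓝 (K * 0)) :=
    (Real.tendsto_exp_atBot.comp h1).const_mul K
  rw [mul_zero] at h3
  exact squeeze_zero_norm (fun y => by rw [Real.norm_eq_abs]; exact h y) h3

/-- A function dominated by `K e^{−k|y|}`, `k > 0`, tends to `0` as `y → −∞`. [folklore] -/
theorem tendsto_zero_atBot_of_abs_le_exp {F : ℝ → ℝ} {K k : ℝ} (hk : 0 < k)
    (h : ∀ y, |F y| ≤ K * Real.exp (-k * |y|)) : Tendsto F atBot (𝓝 0) := by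
  have h1 : Tendsto (fun y : ℝ => -k * |y|) atBot atBot := by
    have h2 := (tendsto_abs_atBot_atTop (G := ℝ)).const_mul_atTop hk
    have h2' : Tendsto (fun y : ℝ => -(k * |y|)) atBot atBot := tendsto_neg_atBot_iff.2 h2
    simpa only [neg_mul] using h2'
  have h3 : Tendsto (fun y : ℝ => K * Real.exp (-k * |y|)) atBot (𝓝 (K * 0)) :=
    (Real.tendsto_exp_atBot.comp h1).const_mul K
  rw [mul_zero] at h3
  exact squeeze_zero_norm (fun y => by rw [Real.norm_eq_abs]; exact h y) h3

/-! ### Pointwise weight bookkeeping for products -/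

/-- A bounded factor is at most quadratically growing: `|g| ≤ M ⇒ |g| ≤ M (1 + |y|)²` (`M ≥ 0`).
[folklore] -/
theorem abs_le_mul_one_add_abs_sq_of_abs_le {g M : ℝ} (y : ℝ) (hM : 0 ≤ M) (h : |g| ≤ M) :
    |g| ≤ M * (1 + |y|) ^ 2 :=
  h.trans (le_mul_of_one_le_right hM (one_le_pow₀ (by linarith [abs_nonneg y])))

/-- A linearly growing factor is at most quadratically growing:
`|g| ≤ M (1 + |y|) ⇒ |g| ≤ M (1 + |y|)²` (`M ≥ 0`). [folklore] -/
theorem abs_le_mul_one_add_abs_sq_of_abs_le_linear {g M : ℝ} (y : ℝ) (hM : 0 ≤ M)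
    (h : |g| ≤ M * (1 + |y|)) : |g| ≤ M * (1 + |y|) ^ 2 := by
  refine h.trans ?_
  have h1 : (1 : ℝ) ≤ 1 + |y| := by linarith [abs_nonneg y]
  have h2 : 0 ≤ M * (1 + |y|) := by positivity
  calc M * (1 + |y|) = M * (1 + |y|) * 1 := (mul_one _).symm
    _ ≤ M * (1 + |y|) * (1 + |y|) := mul_le_mul_of_nonneg_left h1 h2
    _ = M * (1 + |y|) ^ 2 := by ring

/-- Decaying × quadratically growing: `|f| ≤ A e^{−k|y|}`, `|g| ≤ M (1 + |y|)²`, `A ≥ 0` give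
`|f g| ≤ A M (1 + |y|)² e^{−k|y|}`. [folklore] -/
theorem abs_mul_le_weight {f g A M k : ℝ} (y : ℝ) (hA : 0 ≤ A)
    (hf : |f| ≤ A * Real.exp (-k * |y|)) (hg : |g| ≤ M * (1 + |y|) ^ 2) :
    |f * g| ≤ A * M * ((1 + |y|) ^ 2 * Real.exp (-k * |y|)) := by
  rw [abs_mul]
  have hM : 0 ≤ M * (1 + |y|) ^ 2 := (abs_nonneg _).trans hg
  calc |f| * |g| ≤ A * Real.exp (-k * |y|) * (M * (1 + |y|) ^ 2) :=
        mul_le_mul hf hg (abs_nonneg _) (mul_nonneg hA (Real.exp_pos _).le)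
    _ = A * M * ((1 + |y|) ^ 2 * Real.exp (-k * |y|)) := by ring

/-- Quadratically growing × decaying (the symmetric form of `abs_mul_le_weight`). [folklore] -/
theorem abs_mul_le_weight' {f g A M k : ℝ} (y : ℝ) (hA : 0 ≤ A)
    (hg : |g| ≤ M * (1 + |y|) ^ 2) (hf : |f| ≤ A * Real.exp (-k * |y|)) :
    |g * f| ≤ A * M * ((1 + |y|) ^ 2 * Real.exp (-k * |y|)) := by
  rw [mul_comm]
  exact abs_mul_le_weight y hA hf hg

/-- Products of bounded factors: `|g₁| ≤ M₁`, `|g₂| ≤ M₂` give `|g₁ g₂| ≤ M₁ M₂` (private copy;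
a public version is `Literature.Analysis.FluidPDE.CompressibleEuler.abs_mul_le_of_le`, not in this
import closure). [folklore] -/
private theorem abs_mul_le_mul_of_abs_le {g₁ g₂ M₁ M₂ : ℝ} (h₁ : |g₁| ≤ M₁) (h₂ : |g₂| ≤ M₂) :
    |g₁ * g₂| ≤ M₁ * M₂ := by
  rw [abs_mul]
  exact mul_le_mul h₁ h₂ (abs_nonneg _) ((abs_nonneg _).trans h₁)

/-- The strain coefficient `|V − γy| ≤ (M + |γ|)(1 + |y|)` when `|V| ≤ M`, `M ≥ 0`. [folklore] -/
theorem abs_sub_mul_le_linear {V M γ : ℝ} (y : ℝ) (hM : 0 ≤ M) (h : |V| ≤ M) :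
    |V - γ * y| ≤ (M + |γ|) * (1 + |y|) := by
  calc |V - γ * y| ≤ |V| + |γ * y| := abs_sub _ _
    _ ≤ M + |γ| * |y| := by rw [abs_mul]; exact add_le_add_left h _
    _ ≤ (M + |γ|) * (1 + |y|) := by nlinarith [abs_nonneg γ, abs_nonneg y]

/-! ### Integrability on the strip -/

/-- A continuous function on the plane dominated on the strip `(0, L] × ℝ` by an integrable
function of `y` alone is integrable on the strip. [folklore] -/
theorem integrableOn_strip_of_abs_le {L : ℝ} {F : ℝ × ℝ → ℝ} (hF : Continuous F) {g : ℝ → ℝ}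
    (hg : Integrable g) (h : ∀ x ∈ Ioc 0 L, ∀ y, |F (x, y)| ≤ g y) :
    IntegrableOn F (Ioc 0 L ×ˢ univ) := by
  have hae := ae_fst_mem_Ioc_strip L
  rw [volume_restrict_strip] at hae
  rw [IntegrableOn, volume_restrict_strip]
  refine Integrable.mono' (hg.comp_snd _) hF.aestronglyMeasurable ?_
  filter_upwards [hae] with q hq
  rw [Real.norm_eq_abs]
  exact h q.1 hq q.2

/-- A continuous function bounded on the strip by `C (1 + |y|)² e^{−k|y|}`, `k > 0`, is integrable
on the strip. [folklore] -/
theorem integrableOn_strip_of_abs_le_sq_exp {L : ℝ} {F : ℝ × ℝ → ℝ} (hF : Continuous F)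
    {C k : ℝ} (hk : 0 < k)
    (h : ∀ x ∈ Ioc 0 L, ∀ y, |F (x, y)| ≤ C * ((1 + |y|) ^ 2 * Real.exp (-k * |y|))) :
    IntegrableOn F (Ioc 0 L ×ˢ univ) :=
  integrableOn_strip_of_abs_le hF ((integrable_one_add_abs_sq_mul_exp hk).const_mul C) h

/-- A continuous function bounded on the strip by `C e^{−k|y|}`, `k > 0`, `C ≥ 0`, is integrable
on the strip. [folklore] -/
theorem integrableOn_strip_of_abs_le_exp {L : ℝ} {F : ℝ × ℝ → ℝ} (hF : Continuous F)
    {C k : ℝ} (hC : 0 ≤ C) (hk : 0 < k)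
    (h : ∀ x ∈ Ioc 0 L, ∀ y, |F (x, y)| ≤ C * Real.exp (-k * |y|)) :
    IntegrableOn F (Ioc 0 L ×ˢ univ) :=
  integrableOn_strip_of_abs_le_sq_exp hF hk fun x hx y =>
    (h x hx y).trans (mul_le_mul_of_nonneg_left (exp_le_one_add_abs_sq_mul_exp k y) hC)

/-! ### Integration by parts on the strip -/

/-- **Integration by parts in `x` over a period.** For plane fields `f, g` with `x`-slices
differentiable everywhere (derivatives `f', g'`, continuous in `x`), `fg` taking the same values
at `x = 0` and `x = L` (`0 ≤ L`), and `f g'`, `f' g` integrable on the strip,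
`∫∫_{(0,L]×ℝ} f ∂ₓg = −∫∫_{(0,L]×ℝ} ∂ₓf g` (Fubini and the interval formula; the boundary terms
cancel by periodicity). [folklore] -/
theorem integral_strip_mul_dX_eq_neg {L : ℝ} (hL : 0 ≤ L) {f g f' g' : ℝ → ℝ → ℝ}
    (hf : ∀ x y, HasDerivAt (fun s => f s y) (f' x y) x)
    (hg : ∀ x y, HasDerivAt (fun s => g s y) (g' x y) x)
    (hf'c : ∀ y, Continuous fun x => f' x y) (hg'c : ∀ y, Continuous fun x => g' x y)
    (hper : ∀ y, f L y * g L y = f 0 y * g 0 y)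
    (hI1 : IntegrableOn (fun q : ℝ × ℝ => f q.1 q.2 * g' q.1 q.2) (Ioc 0 L ×ˢ univ))
    (hI2 : IntegrableOn (fun q : ℝ × ℝ => f' q.1 q.2 * g q.1 q.2) (Ioc 0 L ×ˢ univ)) :
    ∫ q in Ioc 0 L ×ˢ univ, f q.1 q.2 * g' q.1 q.2 =
      -∫ q in Ioc 0 L ×ˢ univ, f' q.1 q.2 * g q.1 q.2 := by
  rw [IntegrableOn, volume_restrict_strip] at hI1 hI2
  rw [volume_restrict_strip, integral_prod_symm _ hI1, integral_prod_symm _ hI2,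
    ← MeasureTheory.integral_neg]
  refine integral_congr_ae (Eventually.of_forall fun y => ?_)
  simp only
  rw [← intervalIntegral.integral_of_le hL, ← intervalIntegral.integral_of_le hL,
    intervalIntegral.integral_mul_deriv_eq_deriv_mul (fun x _ => hf x y) (fun x _ => hg x y)
      ((hf'c y).intervalIntegrable _ _) ((hg'c y).intervalIntegrable _ _), hper y, sub_self,
    zero_sub]

/-- **Integration by parts in `y` across the layer.** For plane fields `f, g` with `y`-slices
differentiable everywhere (derivatives `f', g'`) and `f g'`, `f' g`, `f g` integrable on the
strip, `∫∫_{(0,L]×ℝ} f ∂_yg = −∫∫_{(0,L]×ℝ} ∂_yf g` (Fubini and Mathlib's whole-line formula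
`integral_mul_deriv_eq_deriv_mul_of_integrable` on almost every slice). [folklore] -/
theorem integral_strip_mul_dY_eq_neg {L : ℝ} {f g f' g' : ℝ → ℝ → ℝ}
    (hf : ∀ x y, HasDerivAt (fun s => f x s) (f' x y) y)
    (hg : ∀ x y, HasDerivAt (fun s => g x s) (g' x y) y)
    (hI1 : IntegrableOn (fun q : ℝ × ℝ => f q.1 q.2 * g' q.1 q.2) (Ioc 0 L ×ˢ univ))
    (hI2 : IntegrableOn (fun q : ℝ × ℝ => f' q.1 q.2 * g q.1 q.2) (Ioc 0 L ×ˢ univ))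
    (hI3 : IntegrableOn (fun q : ℝ × ℝ => f q.1 q.2 * g q.1 q.2) (Ioc 0 L ×ˢ univ)) :
    ∫ q in Ioc 0 L ×ˢ univ, f q.1 q.2 * g' q.1 q.2 =
      -∫ q in Ioc 0 L ×ˢ univ, f' q.1 q.2 * g q.1 q.2 := by
  rw [IntegrableOn, volume_restrict_strip] at hI1 hI2 hI3
  rw [volume_restrict_strip, integral_prod _ hI1, integral_prod _ hI2,
    ← MeasureTheory.integral_neg]
  refine integral_congr_ae ?_
  filter_upwards [hI1.prod_right_ae, hI2.prod_right_ae, hI3.prod_right_ae] with x h1 h2 h3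
  exact integral_mul_deriv_eq_deriv_mul_of_integrable (fun y _ => hf x y) (fun y _ => hg x y)
    h1 h2 h3

/-- **One-sided second-order integration by parts on a line**: if `f f′ → 0` at `±∞`, `f′` has
derivative `f″` (continuous) and `f f″` is integrable, then `∫ f f″ ≤ 0` — on `[-R, R]`,
`∫ f f″ = [f f′] − ∫ (f′)² ≤ [f f′]`, and `R → ∞`. No integrability of `(f′)²` is presupposed.
[folklore] -/
theorem integral_mul_deriv_deriv_self_nonpos {f f' f'' : ℝ → ℝ} (hf : ∀ y, HasDerivAt f (f' y) y)
    (hf' : ∀ y, HasDerivAt f' (f'' y) y) (hf''c : Continuous f'')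
    (hI : Integrable fun y => f y * f'' y)
    (htop : Tendsto (fun y => f y * f' y) atTop (𝓝 0))
    (hbot : Tendsto (fun y => f y * f' y) atBot (𝓝 0)) :
    ∫ y, f y * f'' y ≤ 0 := by
  have hf'c : Continuous f' := continuous_iff_continuousAt.2 fun y => (hf' y).continuousAt
  have hlim : Tendsto (fun R : ℝ => ∫ y in (-R)..R, f y * f'' y) atTop (𝓝 (∫ y, f y * f'' y)) :=
    intervalIntegral_tendsto_integral hI tendsto_neg_atTop_atBot tendsto_id
  have hbd : Tendsto (fun R : ℝ => f R * f' R - f (-R) * f' (-R)) atTop (𝓝 (0 - 0)) :=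
    htop.sub (hbot.comp tendsto_neg_atTop_atBot)
  rw [sub_zero] at hbd
  refine le_of_tendsto_of_tendsto hlim hbd ?_
  filter_upwards [eventually_ge_atTop 0] with R hR
  have hibp := intervalIntegral.integral_mul_deriv_eq_deriv_mul (a := -R) (b := R)
    (fun y _ => hf y) (fun y _ => hf' y) (hf'c.intervalIntegrable _ _)
    (hf''c.intervalIntegrable _ _)
  rw [hibp]
  have h0 : 0 ≤ ∫ y in (-R)..R, f' y * f' y :=
    intervalIntegral.integral_nonneg (by linarith) fun y _ => mul_self_nonneg _
  linarith

/-- **The viscous term across the layer is dissipative**: for a plane field `f` whose `y`-slices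
are twice differentiable (`∂_yf = f'`, `∂_y f' = f''`, `f''` continuous along slices), with
`f f''` integrable on the strip and `f ∂_yf → 0` as `|y| → ∞` on every slice,
`∫∫_{(0,L]×ℝ} f ∂_y∂_yf ≤ 0`. [folklore] -/
theorem integral_strip_mul_dYdY_self_nonpos {L : ℝ} {f f' f'' : ℝ → ℝ → ℝ}
    (hf : ∀ x y, HasDerivAt (fun s => f x s) (f' x y) y)
    (hf' : ∀ x y, HasDerivAt (fun s => f' x s) (f'' x y) y)
    (hf''c : ∀ x, Continuous fun y => f'' x y)
    (hI : IntegrableOn (fun q : ℝ × ℝ => f q.1 q.2 * f'' q.1 q.2) (Ioc 0 L ×ˢ univ))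
    (htop : ∀ x, Tendsto (fun y => f x y * f' x y) atTop (𝓝 0))
    (hbot : ∀ x, Tendsto (fun y => f x y * f' x y) atBot (𝓝 0)) :
    ∫ q in Ioc 0 L ×ˢ univ, f q.1 q.2 * f'' q.1 q.2 ≤ 0 := by
  rw [IntegrableOn, volume_restrict_strip] at hI
  rw [volume_restrict_strip, integral_prod _ hI]
  refine integral_nonpos_of_ae ?_
  filter_upwards [hI.prod_right_ae] with x hx
  exact integral_mul_deriv_deriv_self_nonpos (hf x) (hf' x) (hf''c x) hx (htop x) (hbot x)

/-- **In `x` the viscous term is dissipative too**: `∫∫ f ∂ₓ∂ₓf = −∫∫ (∂ₓf)² ≤ 0` for periodic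
data (a corollary of `integral_strip_mul_dX_eq_neg`). [folklore] -/
theorem integral_strip_mul_dXdX_self_nonpos {L : ℝ} (hL : 0 ≤ L) {f f' f'' : ℝ → ℝ → ℝ}
    (hf : ∀ x y, HasDerivAt (fun s => f s y) (f' x y) x)
    (hf' : ∀ x y, HasDerivAt (fun s => f' s y) (f'' x y) x)
    (hf'c : ∀ y, Continuous fun x => f' x y) (hf''c : ∀ y, Continuous fun x => f'' x y)
    (hper : ∀ y, f L y * f' L y = f 0 y * f' 0 y)
    (hI1 : IntegrableOn (fun q : ℝ × ℝ => f q.1 q.2 * f'' q.1 q.2) (Ioc 0 L ×ˢ univ))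
    (hI2 : IntegrableOn (fun q : ℝ × ℝ => f' q.1 q.2 * f' q.1 q.2) (Ioc 0 L ×ˢ univ)) :
    ∫ q in Ioc 0 L ×ˢ univ, f q.1 q.2 * f'' q.1 q.2 ≤ 0 := by
  rw [integral_strip_mul_dX_eq_neg hL hf hf' hf'c hf''c hper hI1 hI2, neg_nonpos]
  exact setIntegral_nonneg (measurableSet_Ioc.prod MeasurableSet.univ) fun q _ =>
    mul_self_nonneg _

end StretchedLayer

end Literature.Analysis.FluidPDE
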